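import Mathlib
import HarnessLib

/-!
# The 2-closure of a permutation group (Wielandt)

Topic `Literature/GroupTheory/PermutationGroups`.  Wielandt's *2-closure* `G⁽²⁾` of a permutation
group `G ≤ Sym(α)` (Wielandt, *Permutation groups through invariant relations and invariant
functions*, Ohio State 1969): the group of all permutations which preserve every orbit of `G` on
ordered pairs (every *orbital*), i.e. which agree on every pair of points with some element of `G`.
This is the basic object of "Wielandt's method" (invariant relations) behind the exponential order
bounds for primitive groups that are not doubly transitive (Wielandt 1969; Praeger–Saxl 1980).

Definition `twoClosure G` and its elementary properties, all PROVED: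
* `le_twoClosure`, `twoClosure_mono`, `twoClosure_twoClosure` (closure operator);
* `exists_mem_apply_eq` (same orbits on points), `isPretransitive_twoClosure_iff`;
* `isBlock_twoClosure_iff` (same blocks), `isPreprimitive_twoClosure_iff` (primitivity is preserved);
* `isMultiplyPretransitive_two_twoClosure_iff` (`2`-transitivity is preserved — same orbitals);
* `not_alternatingGroup_le_twoClosure` — if `G` is not `2`-transitive and `|α| ≥ 4` then `Aₙ ≰ G⁽²⁾`.
So for order bounds on a uniprimitive group one may pass to its (larger) 2-closure.
-/

namespace Literature.GroupTheory.PermutationGroups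

open Equiv Equiv.Perm MulAction
open scoped Pointwise

variable {α : Type*}

/-- **Wielandt's 2-closure** of `G ≤ Sym(α)`: the permutations `π` such that for all points `x, y`
some `g ∈ G` has `g x = π x` and `g y = π y` (equivalently: `π` preserves every orbit of `G` on
`α × α`).  It is a subgroup containing `G`. [folklore] -/
def twoClosure (G : Subgroup (Perm α)) : Subgroup (Perm α) where
  carrier := {π | ∀ x y : α, ∃ g ∈ G, g x = π x ∧ g y = π y}
  one_mem' := fun x y => ⟨1, G.one_mem, rfl, rfl⟩
  mul_mem' := by
    intro π σ hπ hσ x y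
    obtain ⟨h, hh, hhx, hhy⟩ := hσ x y
    obtain ⟨g, hg, hgx, hgy⟩ := hπ (σ x) (σ y)
    refine ⟨g * h, G.mul_mem hg hh, ?_, ?_⟩
    · rw [Perm.mul_apply, hhx, hgx, Perm.mul_apply]
    · rw [Perm.mul_apply, hhy, hgy, Perm.mul_apply]
  inv_mem' := by
    intro π hπ x y
    obtain ⟨g, hg, hgx, hgy⟩ := hπ (π⁻¹ x) (π⁻¹ y)
    refine ⟨g⁻¹, G.inv_mem hg, ?_, ?_⟩
    · rw [Perm.inv_eq_iff_eq, hgx]; exact (π.apply_symm_apply x).symm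
    · rw [Perm.inv_eq_iff_eq, hgy]; exact (π.apply_symm_apply y).symm

/-- Membership in the 2-closure, unfolded. [folklore] -/
theorem mem_twoClosure_iff {G : Subgroup (Perm α)} {π : Perm α} :
    π ∈ twoClosure G ↔ ∀ x y : α, ∃ g ∈ G, g x = π x ∧ g y = π y := Iff.rfl

/-- `G ≤ G⁽²⁾`. [folklore] -/
theorem le_twoClosure (G : Subgroup (Perm α)) : G ≤ twoClosure G :=
  fun g hg _ _ => ⟨g, hg, rfl, rfl⟩

/-- The 2-closure is monotone. [folklore] -/
theorem twoClosure_mono {G H : Subgroup (Perm α)} (h : G ≤ H) : twoClosure G ≤ twoClosure H := by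
  intro π hπ x y
  obtain ⟨g, hg, hgx, hgy⟩ := hπ x y
  exact ⟨g, h hg, hgx, hgy⟩

/-- The 2-closure is idempotent: `(G⁽²⁾)⁽²⁾ = G⁽²⁾` (2-closed groups). [folklore] -/
theorem twoClosure_twoClosure (G : Subgroup (Perm α)) :
    twoClosure (twoClosure G) = twoClosure G := by
  refine le_antisymm ?_ (le_twoClosure _)
  intro π hπ x y
  obtain ⟨σ, hσ, hσx, hσy⟩ := hπ x y
  obtain ⟨g, hg, hgx, hgy⟩ := hσ x y
  exact ⟨g, hg, hgx.trans hσx, hgy.trans hσy⟩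

/-- Elements of the 2-closure agree with elements of `G` on each point: `G` and `G⁽²⁾` have the same
orbits. [folklore] -/
theorem exists_mem_apply_eq {G : Subgroup (Perm α)} {π : Perm α} (hπ : π ∈ twoClosure G) (x : α) :
    ∃ g ∈ G, g x = π x := by
  obtain ⟨g, hg, hgx, -⟩ := hπ x x
  exact ⟨g, hg, hgx⟩

/-- `G⁽²⁾` is transitive iff `G` is. [folklore] -/
theorem isPretransitive_twoClosure_iff (G : Subgroup (Perm α)) :
    IsPretransitive (twoClosure G) α ↔ IsPretransitive G α := by
  constructor
  · intro h
    refine ⟨fun x y => ?_⟩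
    obtain ⟨π, hπ⟩ := h.exists_smul_eq x y
    obtain ⟨g, hg, hgx⟩ := exists_mem_apply_eq π.2 x
    refine ⟨⟨g, hg⟩, ?_⟩
    rw [Subgroup.mk_smul, Perm.smul_def, hgx]
    exact hπ
  · intro h
    refine ⟨fun x y => ?_⟩
    obtain ⟨g, hg⟩ := h.exists_smul_eq x y
    exact ⟨⟨g, le_twoClosure G g.2⟩, hg⟩

/-- A block for `G` is a block for `G⁽²⁾` (and conversely): the 2-closure preserves every
`G`-invariant partition. [folklore] -/
theorem isBlock_twoClosure_iff (G : Subgroup (Perm α)) (B : Set α) :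
    IsBlock (twoClosure G) B ↔ IsBlock G B := by
  constructor
  · intro hB
    rw [isBlock_iff_smul_eq_or_disjoint] at hB ⊢
    intro g
    exact hB ⟨g, le_twoClosure G g.2⟩
  · intro hB
    rw [isBlock_iff_smul_eq_or_disjoint] at hB ⊢
    rintro ⟨π, hπ⟩
    by_cases hdisj : _root_.Disjoint ((⟨π, hπ⟩ : twoClosure G) • B) B
    · exact Or.inr hdisj
    · left
      -- some `b ∈ B` with `π b ∈ B`; then every `π b' ∈ B`
      rw [Set.not_disjoint_iff] at hdisj
      obtain ⟨z, hz1, hz2⟩ := hdisj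
      obtain ⟨b, hb, rfl⟩ := hz1
      have key : ∀ b' ∈ B, π b' ∈ B := by
        intro b' hb'
        obtain ⟨g, hg, hgb, hgb'⟩ := hπ b b'
        have hgB : (⟨g, hg⟩ : G) • B = B := by
          rcases hB ⟨g, hg⟩ with h | h
          · exact h
          · exfalso
            refine Set.disjoint_left.mp h ⟨b, hb, ?_⟩ hz2
            change g b = π b
            exact hgb
        have : (⟨g, hg⟩ : G) • b' ∈ (⟨g, hg⟩ : G) • B := Set.smul_mem_smul_set hb'
        rw [hgB] at this
        change g b' ∈ B at this
        rwa [hgb'] at this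
      -- `π B ⊆ B`, and by injectivity and finiteness-free counting via the inverse: use `π⁻¹` too
      apply Set.Subset.antisymm
      · rintro _ ⟨b', hb', rfl⟩
        exact key b' hb'
      · intro b' hb'
        -- `π⁻¹ b' ∈ B` by the same argument applied to `π⁻¹ ∈ G⁽²⁾` at the pair `(π b, b')`
        have hπinv : π⁻¹ ∈ twoClosure G := (twoClosure G).inv_mem hπ
        obtain ⟨g, hg, hg1, hg2⟩ := hπinv (π b) b'
        rw [show π⁻¹ (π b) = b from π.symm_apply_apply b] at hg1
        have hgB : (⟨g, hg⟩ : G) • B = B := by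
          rcases hB ⟨g, hg⟩ with h | h
          · exact h
          · exfalso
            refine Set.disjoint_left.mp h ⟨π b, hz2, ?_⟩ hb
            change g (π b) = b
            exact hg1
        have hmem : (⟨g, hg⟩ : G) • b' ∈ (⟨g, hg⟩ : G) • B := Set.smul_mem_smul_set hb'
        rw [hgB] at hmem
        change g b' ∈ B at hmem
        rw [hg2] at hmem
        refine ⟨π⁻¹ b', hmem, ?_⟩
        change π (π⁻¹ b') = b'
        exact π.apply_symm_apply b'

/-- `G⁽²⁾` is primitive iff `G` is. [folklore] -/
theorem isPreprimitive_twoClosure_iff (G : Subgroup (Perm α)) :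
    IsPreprimitive (twoClosure G) α ↔ IsPreprimitive G α := by
  constructor
  · intro h
    haveI : IsPretransitive G α := (isPretransitive_twoClosure_iff G).mp h.toIsPretransitive
    exact IsPreprimitive.mk fun hB => h.isTrivialBlock_of_isBlock ((isBlock_twoClosure_iff G _).mpr hB)
  · intro h
    haveI : IsPretransitive (twoClosure G) α := (isPretransitive_twoClosure_iff G).mpr h.toIsPretransitive
    exact IsPreprimitive.mk fun hB => h.isTrivialBlock_of_isBlock ((isBlock_twoClosure_iff G _).mp hB)

/-- `G⁽²⁾` is `2`-transitive iff `G` is (they have the same orbits on ordered pairs). [folklore] -/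
theorem isMultiplyPretransitive_two_twoClosure_iff (G : Subgroup (Perm α)) :
    IsMultiplyPretransitive (twoClosure G) α 2 ↔ IsMultiplyPretransitive G α 2 := by
  rw [is_two_pretransitive_iff, is_two_pretransitive_iff]
  constructor
  · intro h a b c d hab hcd
    obtain ⟨π, hπa, hπb⟩ := h hab hcd
    obtain ⟨g, hg, hga, hgb⟩ := π.2 a b
    refine ⟨⟨g, hg⟩, ?_, ?_⟩
    · rw [Subgroup.mk_smul, Perm.smul_def, hga]; exact hπa
    · rw [Subgroup.mk_smul, Perm.smul_def, hgb]; exact hπb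
  · intro h a b c d hab hcd
    obtain ⟨g, hga, hgb⟩ := h hab hcd
    exact ⟨⟨g, le_twoClosure G g.2⟩, hga, hgb⟩

/-- If `G` is not `2`-transitive on a finite set with at least `4` points, then its 2-closure does
not contain the alternating group (which is `2`-transitive there).  Hence bounds for primitive
groups not containing `Aₙ` may be proved for 2-closed groups when `G` is not `2`-transitive.
[folklore] -/
theorem not_alternatingGroup_le_twoClosure [Fintype α] [DecidableEq α] (G : Subgroup (Perm α))
    (h4 : 4 ≤ Fintype.card α) (h2t : ¬ IsMultiplyPretransitive G α 2) :
    ¬ alternatingGroup α ≤ twoClosure G := by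
  intro hle
  apply h2t
  rw [← isMultiplyPretransitive_two_twoClosure_iff]
  -- `Aₙ` is `(n-2)`-transitive, hence `2`-transitive as `n ≥ 4`, and so is any overgroup
  have hA : IsMultiplyPretransitive (alternatingGroup α) α 2 := by
    have := alternatingGroup.isMultiplyPretransitive α
    rw [Nat.card_eq_fintype_card] at this
    haveI := this
    exact isMultiplyPretransitive_of_le (n := Fintype.card α - 2) (by omega)
      (by rw [Nat.card_eq_fintype_card]; omega)
  rw [is_two_pretransitive_iff] at hA ⊢
  intro a b c d hab hcd
  obtain ⟨g, hga, hgb⟩ := hA hab hcd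
  exact ⟨⟨g, hle g.2⟩, hga, hgb⟩

end Literature.GroupTheory.PermutationGroups
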